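import Summits.AnomalousDissipation.AnomalousDissipation.Theorems.SoloBlindShearStates
import Mathlib.NumberTheory.Transcendental.Liouville.LiouvilleNumber
import Mathlib.Analysis.SpecificLimits.Normed

/-!
# The small-divisor rung: bounded energy, unbounded enstrophy for a fixed smooth force (solo soloist, blind mode)

`Literature.Turb.ZerothLaw` (= the summit `AnomalousDissipation`) asks for a FIXED smooth force
and Leray–Hopf solutions along `νⱼ → 0⁺` with mean energy `O(1)` and mean dissipation
`νⱼ⟪‖∇uⱼ‖²⟫ ≥ ε > 0`. The laminar (drifted, steady) states of the tree all have dissipation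
`O(νⱼ)` at bounded energy (`SoloBlindDriftScreening`, `SoloBlindSweeping…`): bounded enstrophy.
This file climbs the FIRST RUNG of the rate ladder in between: a fixed smooth force with
bounded-energy Leray–Hopf families whose enstrophy `⟪‖∇uⱼ‖²⟫ = dissipation / νⱼ` DIVERGES along
EVERY vanishing viscosity sequence (`exists_force_boundedEnergy_unboundedEnstrophy`).

Mechanism (small divisors). Take the shear design (`SoloBlindShearDesign`) with modes
`Kₙ = (0, qₙ, -pₙ)`, `qₙ = 10^{n!}`, `pₙ/qₙ` the partial sums of Liouville's constant
`L = ∑ 10^{-i!}`, momentum `M = (0, L, 1)`, so that the divisors `Kₙ·M = qₙ L − pₙ = dₙ` are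
positive but super-polynomially small (`dₙ < qₙ^{1-n}`, Mathlib's `LiouvilleNumber.remainder_lt`),
and amplitudes `aₙ = 2π dₙ 2^{-n}` (smooth force: `aₙ` decays faster than any power of `|Kₙ|`).
The laminar states `u = M + Re ∑ σ_ν(k)⁻¹ F(k) e_k e₁` of `SoloBlindShearStates` then have
energy `≤ ‖M‖² + 2∑ₙ aₙ²/(2π dₙ)² = ‖M‖² + 8/3` for all `ν`, while the mode `n` alone contributes
`≥ 2π² |Kₙ|² 4^{-n} ≥ 2π² 25^{n}` to the enstrophy as soon as `4π²ν|Kₙ|² ≤ 2π dₙ`.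
(By dominated convergence the dissipation `ν⟪‖∇u‖²⟫` of this family still tends to zero — the
rung is strictly below the summit; that upper bound is not formalised here.) [folklore]
-/

open MeasureTheory Filter Topology Set UnitAddTorus Function
open scoped ENNReal NNReal

noncomputable section

namespace Summit.AnomalousDissipation.AnomalousDissipation.Theorems

open Literature.Analysis.FunctionSpaces Literature.Analysis.FunctionSpaces.Torus
open Literature.Analysis.FunctionSpaces.EuclideanSpace
open Literature.Analysis.FluidPDE

/-- The physical flat unit torus `T³` (local notation). -/
local notation "𝕋³" => UnitAddTorus (Fin 3)
/-- Velocity values on `T³` (local notation). -/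
local notation "E³" => EuclideanSpace ℝ (Fin 3)
/-- Complex coefficient vectors (local notation). -/
local notation "ℂ³" => EuclideanSpace ℂ (Fin 3)

namespace SmallDivisor

open LiouvilleNumber

/-! ### The Liouville design -/

/-- Denominators `qₙ = 10^{n!}`. -/
def q (n : ℕ) : ℕ := 10 ^ n.factorial

/-- Numerators `pₙ = ∑_{i ≤ n} 10^{n! - i!}` (`pₙ / qₙ` = the `n`-th partial sum of Liouville's constant). -/
def pnum (n : ℕ) : ℕ := ∑ i ∈ Finset.range (n + 1), 10 ^ (n.factorial - i.factorial)

/-- Liouville's constant `L = ∑ 10^{-i!}`. -/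
def L : ℝ := liouvilleNumber 10

/-- The small divisors `dₙ = qₙ · (L − pₙ/qₙ)`. -/
def d (n : ℕ) : ℝ := (q n : ℝ) * remainder 10 n

/-- The modes `Kₙ = (0, qₙ, -pₙ)`. -/
def K (n : ℕ) : Fin 3 → ℤ := ![0, (q n : ℤ), -(pnum n : ℤ)]

/-- The momentum vector `M = (0, L, 1)`. -/
def mom : E³ := WithLp.toLp 2 ![0, L, 1]

/-- The amplitudes `aₙ = 2π dₙ 2^{-n}`. -/
def a (n : ℕ) : ℝ := 2 * Real.pi * d n * (1 / 2 : ℝ) ^ n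

/-- Cast of `qₙ` to `ℝ`. -/
theorem cast_q (n : ℕ) : (q n : ℝ) = 10 ^ n.factorial := by simp [q]

/-- `qₙ > 0`. -/
theorem q_pos (n : ℕ) : 0 < q n := by unfold q; positivity

/-- `1 ≤ qₙ`. -/
theorem one_le_q (n : ℕ) : (1 : ℝ) ≤ q n := by exact_mod_cast q_pos n

/-- `100ⁿ ≤ qₙ²` (since `n ≤ n!`). -/
theorem hundred_pow_le_q_sq (n : ℕ) : (100 : ℝ) ^ n ≤ (q n : ℝ) ^ 2 := by
  rw [cast_q, ← pow_mul, show (100 : ℝ) = 10 ^ 2 by norm_num, ← pow_mul]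
  exact pow_le_pow_right₀ (by norm_num) (by linarith [Nat.self_le_factorial n])

/-- `pₙ / qₙ` is the `n`-th partial sum of Liouville's constant. -/
theorem pnum_div_q (n : ℕ) : (pnum n : ℝ) / q n = partialSum 10 n := by
  rw [partialSum, pnum, Nat.cast_sum, Finset.sum_div]
  refine Finset.sum_congr rfl fun i hi => ?_
  have hi' : i.factorial ≤ n.factorial :=
    Nat.factorial_le (Nat.lt_succ_iff.1 (Finset.mem_range.1 hi))
  rw [Nat.cast_pow, cast_q, Nat.cast_ofNat, pow_sub₀ (10 : ℝ) (by norm_num) hi', mul_div_right_comm,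
    div_self (pow_ne_zero _ (by norm_num)), one_mul, one_div]

/-- `dₙ = qₙ L − pₙ`. -/
theorem d_eq (n : ℕ) : d n = (q n : ℝ) * L - pnum n := by
  have h := partialSum_add_remainder (m := 10) (by norm_num) n
  have hq : (q n : ℝ) ≠ 0 := (Nat.cast_pos.2 (q_pos n)).ne'
  have hp : (pnum n : ℝ) = q n * partialSum 10 n := by
    rw [← pnum_div_q, mul_div_cancel₀ _ hq]
  rw [d, L, ← h, hp]; ring

/-- The small divisors are positive. -/
theorem d_pos (n : ℕ) : 0 < d n := mul_pos (Nat.cast_pos.2 (q_pos n)) (remainder_pos (by norm_num) n)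

/-- The divisors are super-polynomially small: `dₙ < qₙ / qₙⁿ`. -/
theorem d_lt (n : ℕ) : d n < (q n : ℝ) / (q n : ℝ) ^ n := by
  rw [d, div_eq_mul_one_div, cast_q]
  exact mul_lt_mul_of_pos_left (remainder_lt n (by norm_num)) (by positivity)

/-- Crude numerator bound `pₙ ≤ (n+1) qₙ`. -/
theorem pnum_le (n : ℕ) : (pnum n : ℝ) ≤ ((n : ℝ) + 1) * q n := by
  have h : pnum n ≤ (n + 1) * q n := by
    unfold pnum q
    calc ∑ i ∈ Finset.range (n + 1), 10 ^ (n.factorial - i.factorial)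
        ≤ ∑ _i ∈ Finset.range (n + 1), 10 ^ n.factorial :=
          Finset.sum_le_sum fun i _ => Nat.pow_le_pow_right (by norm_num) (Nat.sub_le _ _)
      _ = (n + 1) * 10 ^ n.factorial := by rw [Finset.sum_const, Finset.card_range, smul_eq_mul]
  exact_mod_cast h

/-- First component of `Kₙ`. -/
theorem K_apply_zero (n : ℕ) : K n 0 = 0 := rfl
/-- Second component of `Kₙ`. -/
theorem K_apply_one (n : ℕ) : K n 1 = q n := rfl
/-- Third component of `Kₙ`. -/
theorem K_apply_two (n : ℕ) : K n 2 = -(pnum n : ℤ) := rfl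

/-- `|Kₙ|² = qₙ² + pₙ²`. -/
theorem freqNormSq_K (n : ℕ) : freqNormSq (K n) = (q n : ℝ) ^ 2 + (pnum n : ℝ) ^ 2 := by
  simp [freqNormSq, Fin.sum_univ_three, K_apply_zero, K_apply_one, K_apply_two]

/-- `qₙ² ≤ |Kₙ|²`. -/
theorem q_sq_le_freqNormSq_K (n : ℕ) : (q n : ℝ) ^ 2 ≤ freqNormSq (K n) := by
  rw [freqNormSq_K]; nlinarith

/-- Polynomial bound `1 + |Kₙ|² ≤ ((n+1)² + 2) qₙ²`. -/
theorem one_add_freqNormSq_K_le (n : ℕ) :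
    1 + freqNormSq (K n) ≤ (((n : ℝ) + 2) * q n) ^ 2 := by
  rw [freqNormSq_K]
  have h1 := one_le_q n
  have h2 := pnum_le n
  have h3 : (0 : ℝ) ≤ pnum n := Nat.cast_nonneg _
  nlinarith [mul_le_mul h2 h2 h3 (by positivity), sq_nonneg ((n : ℝ) + 1)]

/-- The divisor of mode `n` is `Kₙ·M = dₙ`. -/
theorem kdot_K_mom (n : ℕ) : kdot (K n) mom = d n := by
  simp [kdot, mom, Fin.sum_univ_three, K_apply_zero, K_apply_one, K_apply_two, d_eq, sub_eq_add_neg]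

/-- The partial sums of Liouville's series increase strictly. -/
theorem partialSum_strictMono : StrictMono (partialSum 10) :=
  strictMono_nat_of_lt_succ fun n => by
    rw [partialSum_succ]; exact lt_add_of_pos_right _ (by positivity)

/-- The modes `Kₙ` are pairwise distinct. -/
theorem K_injective : Injective K := by
  intro n m h
  have h1 : (q n : ℤ) = q m := by
    have := congrFun h 1; rwa [K_apply_one, K_apply_one] at this
  have h2 : -(pnum n : ℤ) = -(pnum m : ℤ) := by
    have := congrFun h 2; rwa [K_apply_two, K_apply_two] at this
  have h1' : q n = q m := by exact_mod_cast h1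
  have h2' : pnum n = pnum m := by exact_mod_cast neg_injective h2
  apply partialSum_strictMono.injective
  rw [← pnum_div_q, ← pnum_div_q, h1', h2']

/-- No mode is the negative of another (all `qₙ > 0`). -/
theorem K_ne_neg (n m : ℕ) : K n ≠ -K m := by
  intro h
  have h1 : (q n : ℤ) = -(q m : ℤ) := by
    have := congrFun h 1; rwa [Pi.neg_apply, K_apply_one, K_apply_one] at this
  have h2 := q_pos n
  have h3 := q_pos m
  omega

/-- `|aₙ| ≤ 2π (qₙ/qₙⁿ) 2^{-n}`. -/
theorem abs_a_le (n : ℕ) : |a n| ≤ 2 * Real.pi * ((q n : ℝ) / (q n : ℝ) ^ n) * (1 / 2 : ℝ) ^ n := by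
  have hd := d_pos n
  rw [a, abs_of_nonneg (by positivity)]
  gcongr
  exact (d_lt n).le

/-- The polynomial × geometric majorant is summable. -/
theorem summable_polyGeom (m : ℕ) :
    Summable fun n : ℕ => ((n : ℝ) + 2) ^ (2 * m) * (1 / 2 : ℝ) ^ n := by
  have h0 : Summable (fun n : ℕ => (n : ℝ) ^ (2 * m) * (1 / 2 : ℝ) ^ n) :=
    summable_pow_mul_geometric_of_norm_lt_one (2 * m)
      (by rw [Real.norm_eq_abs, abs_of_pos (by norm_num)]; norm_num)
  have h := ((summable_nat_add_iff (f := fun n : ℕ => (n : ℝ) ^ (2 * m) * (1 / 2 : ℝ) ^ n)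
    2).2 h0).mul_left 4
  refine h.congr fun n => ?_
  simp only [Nat.cast_add, Nat.cast_ofNat, pow_add]
  ring

/-- Pointwise majorant in the tail `n ≥ 2m+1`:
`(1 + |Kₙ|²)^m |aₙ| ≤ 2π (n+2)^{2m} 2^{-n}`. -/
theorem term_le {m n : ℕ} (hmn : 2 * m + 1 ≤ n) :
    (1 + freqNormSq (K n)) ^ m * |a n| ≤
      2 * Real.pi * (((n : ℝ) + 2) ^ (2 * m) * (1 / 2 : ℝ) ^ n) := by
  have hq1 := one_le_q n
  have hqpos : (0 : ℝ) < q n := by linarith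
  have hKm : (1 + freqNormSq (K n)) ^ m ≤ ((n : ℝ) + 2) ^ (2 * m) * (q n : ℝ) ^ (2 * m) := by
    calc (1 + freqNormSq (K n)) ^ m ≤ ((((n : ℝ) + 2) * q n) ^ 2) ^ m :=
          pow_le_pow_left₀ (by linarith [freqNormSq_nonneg (K n)]) (one_add_freqNormSq_K_le n) m
      _ = ((n : ℝ) + 2) ^ (2 * m) * (q n : ℝ) ^ (2 * m) := by
          rw [← pow_mul, mul_pow, mul_comm 2 m]
  have hqq : (q n : ℝ) ^ (2 * m) * ((q n : ℝ) / (q n : ℝ) ^ n) ≤ 1 := by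
    rw [← mul_div_assoc, ← pow_succ, div_le_one (pow_pos hqpos n)]
    exact pow_le_pow_right₀ hq1 (by omega)
  calc (1 + freqNormSq (K n)) ^ m * |a n|
      ≤ (((n : ℝ) + 2) ^ (2 * m) * (q n : ℝ) ^ (2 * m)) *
          (2 * Real.pi * ((q n : ℝ) / (q n : ℝ) ^ n) * (1 / 2 : ℝ) ^ n) :=
        mul_le_mul hKm (abs_a_le n) (abs_nonneg _) (by positivity)
    _ = 2 * Real.pi * (((n : ℝ) + 2) ^ (2 * m) * (1 / 2 : ℝ) ^ n) *
          ((q n : ℝ) ^ (2 * m) * ((q n : ℝ) / (q n : ℝ) ^ n)) := by ring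
    _ ≤ 2 * Real.pi * (((n : ℝ) + 2) ^ (2 * m) * (1 / 2 : ℝ) ^ n) * 1 :=
        mul_le_mul_of_nonneg_left hqq (by positivity)
    _ = 2 * Real.pi * (((n : ℝ) + 2) ^ (2 * m) * (1 / 2 : ℝ) ^ n) := mul_one _

/-- The amplitudes decay faster than every power of `|Kₙ|` (the force is smooth). -/
theorem decay (m : ℕ) : Summable fun n => (1 + freqNormSq (K n)) ^ m * |a n| := by
  rw [← summable_nat_add_iff (2 * m + 1)]
  have hmaj := ((summable_polyGeom m).mul_left (2 * Real.pi)).comp_injective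
    (add_left_injective (2 * m + 1))
  refine hmaj.of_nonneg_of_le (fun j => mul_nonneg (one_add_freqNormSq_pow_nonneg _ m)
    (abs_nonneg _)) fun j => ?_
  exact term_le (m := m) (n := j + (2 * m + 1)) le_add_self

/-- **The Liouville shear design.** -/
def design : ShearDesign where
  K := K
  a := a
  K_injective := K_injective
  K_zero := K_apply_zero
  K_ne_neg := K_ne_neg
  decay := decay

/-- No mode is resonant: `Kₙ·M = dₙ ≠ 0`. -/
theorem kdot_ne_zero (n : ℕ) : kdot (design.K n) mom ≠ 0 := by
  change kdot (K n) mom ≠ 0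
  rw [kdot_K_mom]; exact (d_pos n).ne'

/-- The energy majorant of the Liouville design is geometric: `aₙ² / (2π dₙ)² = 4^{-n}`. -/
theorem energyMajorant_eq (n : ℕ) : design.energyMajorant mom n = (1 / 4 : ℝ) ^ n := by
  change a n ^ 2 / (2 * Real.pi * kdot (K n) mom) ^ 2 = _
  rw [kdot_K_mom, a]
  have hd := (d_pos n).ne'
  have hπ : Real.pi ≠ 0 := Real.pi_ne_zero
  rw [div_eq_iff (by positivity)]
  have : ((1 : ℝ) / 4) ^ n = ((1 / 2 : ℝ) ^ n) ^ 2 := by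
    rw [← pow_mul, mul_comm n 2, pow_mul]; norm_num
  rw [this]; ring

/-- The energy majorant is summable. -/
theorem summable_energyMajorant : Summable (design.energyMajorant mom) := by
  have : design.energyMajorant mom = fun n => (1 / 4 : ℝ) ^ n := funext energyMajorant_eq
  rw [this]; exact summable_geometric_of_lt_one (by norm_num) (by norm_num)

/-- Its sum is `4/3`. -/
theorem tsum_energyMajorant : ∑' n, design.energyMajorant mom n = 4 / 3 := by
  have : design.energyMajorant mom = fun n => (1 / 4 : ℝ) ^ n := funext energyMajorant_eq
  rw [this, tsum_geometric_of_lt_one (by norm_num) (by norm_num)]; norm_num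

/-- The resonance scale of the mode `n`: `δₙ = dₙ / (2π |Kₙ|²)`. -/
def delta (n : ℕ) : ℝ := d n / (2 * Real.pi * freqNormSq (K n))

/-- `|Kₙ|² > 0`. -/
theorem freqNormSq_K_pos (n : ℕ) : 0 < freqNormSq (K n) :=
  lt_of_lt_of_le (by have := one_le_q n; positivity) (q_sq_le_freqNormSq_K n)

/-- The resonance scales are positive. -/
theorem delta_pos (n : ℕ) : 0 < delta n := by
  unfold delta; have := d_pos n; have := freqNormSq_K_pos n; positivity

/-- **Mode `n` below its resonance scale carries enstrophy `≥ 2π² 25ⁿ`**: for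
`0 ≤ ν ≤ δₙ`, `4π² |Kₙ|² aₙ² / |σ_ν(Kₙ)|² ≥ 2π² |Kₙ|² 4^{-n} ≥ 2π² 25ⁿ`. -/
theorem mode_enstrophy_ge {ν : ℝ} (hν : 0 ≤ ν) {n : ℕ} (hνn : ν ≤ delta n) :
    2 * Real.pi ^ 2 * (25 : ℝ) ^ n ≤
      4 * Real.pi ^ 2 * (freqNormSq (K n) * (a n ^ 2 / ‖shearSymbol ν mom (K n)‖ ^ 2)) := by
  have hd := d_pos n
  have hKpos := freqNormSq_K_pos n
  have hπ := Real.pi_pos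
  -- the symbol below resonance: |σ|² ≤ 2 (2π dₙ)²
  have hs1 : ν * (4 * Real.pi ^ 2 * freqNormSq (K n)) ≤ 2 * Real.pi * d n := by
    have := mul_le_mul_of_nonneg_right hνn (by positivity : (0 : ℝ) ≤ 4 * Real.pi ^ 2 * freqNormSq (K n))
    refine this.trans (le_of_eq ?_)
    unfold delta; field_simp; ring
  have hσ : ‖shearSymbol ν mom (K n)‖ ^ 2 ≤ 2 * (2 * Real.pi * d n) ^ 2 := by
    rw [norm_sq_shearSymbol, kdot_K_mom]
    nlinarith [mul_nonneg hν (by positivity : (0 : ℝ) ≤ 4 * Real.pi ^ 2 * freqNormSq (K n))]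
  have hσpos : 0 < ‖shearSymbol ν mom (K n)‖ ^ 2 := by
    rw [norm_sq_shearSymbol, kdot_K_mom]; positivity
  -- the lower bound
  have h25 : (25 : ℝ) ^ n ≤ freqNormSq (K n) * ((1 / 2 : ℝ) ^ n) ^ 2 := by
    have h := (hundred_pow_le_q_sq n).trans (q_sq_le_freqNormSq_K n)
    have : (25 : ℝ) ^ n = 100 ^ n * ((1 / 2 : ℝ) ^ n) ^ 2 := by
      rw [← pow_mul, mul_comm n 2, pow_mul, ← mul_pow]; norm_num
    rw [this]
    exact mul_le_mul_of_nonneg_right h (by positivity)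
  calc 2 * Real.pi ^ 2 * (25 : ℝ) ^ n
      ≤ 2 * Real.pi ^ 2 * (freqNormSq (K n) * ((1 / 2 : ℝ) ^ n) ^ 2) :=
        mul_le_mul_of_nonneg_left h25 (by positivity)
    _ = 4 * Real.pi ^ 2 * (freqNormSq (K n) * (a n ^ 2 / (2 * (2 * Real.pi * d n) ^ 2))) := by
        rw [a]; field_simp; ring
    _ ≤ 4 * Real.pi ^ 2 * (freqNormSq (K n) * (a n ^ 2 / ‖shearSymbol ν mom (K n)‖ ^ 2)) := by
        gcongr

/-! ### The rung -/

/-- **The small-divisor family.** Along ANY positive viscosity sequence `νⱼ → 0` the laminar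
states of the Liouville design are global Leray–Hopf solutions for its FIXED smooth force, with
mean energy `≤ ‖M‖² + 8/3` and enstrophy `= dissipation/νⱼ → ∞`; the Fourier description is
carried along for later use. [folklore] -/
theorem exists_family (ν : ℕ → ℝ) (hν : ∀ j, 0 < ν j) (hν0 : Tendsto ν atTop (𝓝 0)) :
    ∃ u : ℕ → 𝕋³ → E³,
      (∀ j, Torus.IsGlobalLerayHopf (ν j) (fun _ => design.force) (u j) (fun _ => u j)) ∧
      (∀ j, IsSmooth (u j)) ∧
      (∀ j, meanEnergy (fun _ : ℝ => u j) ≤ ‖mom‖ ^ 2 + 8 / 3) ∧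
      (∀ j, meanDissipation (ν j) (fun _ : ℝ => u j) = ν j * (eGradNormSq (u j)).toReal) ∧
      Tendsto (fun j => meanDissipation (ν j) (fun _ : ℝ => u j) / ν j) atTop atTop ∧
      (∀ j, mFourierCoeff (complexify ∘ u j) =
        design.stateCoeff (ν j) mom +
          (Pi.single (0 : Fin 3 → ℤ) (complexify mom) : (Fin 3 → ℤ) → ℂ³)) ∧
      (∀ j, mFourierCoeff (complexify ∘ u j) 0 = complexify mom) := by
  obtain ⟨u, hLH, hsm, hE, hD, hZ, hco, h0⟩ :=
    design.exists_shearFamily kdot_ne_zero summable_energyMajorant ν hν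
  refine ⟨u, hLH, hsm, fun j => ?_, hD, ?_, hco, h0⟩
  · have := hE j; rw [tsum_energyMajorant] at this; linarith
  · have hq : ∀ j, meanDissipation (ν j) (fun _ : ℝ => u j) / ν j = (eGradNormSq (u j)).toReal := by
      intro j; rw [hD j, mul_div_cancel_left₀ _ (hν j).ne']
    simp_rw [hq]
    refine tendsto_atTop_atTop.2 fun b => ?_
    obtain ⟨n, hn⟩ := pow_unbounded_of_one_lt b (by norm_num : (1 : ℝ) < 25)
    obtain ⟨J, hJ⟩ := (hν0.eventually (gt_mem_nhds (delta_pos n))).exists_forall_of_atTop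
    refine ⟨J, fun j hj => ?_⟩
    have h1 : 2 * Real.pi ^ 2 * (25 : ℝ) ^ n ≤ 4 * Real.pi ^ 2 *
        (freqNormSq (design.K n) * (design.a n ^ 2 / ‖shearSymbol (ν j) mom (design.K n)‖ ^ 2)) :=
      mode_enstrophy_ge (hν j).le (hJ j hj).le
    have h2 := hZ j (n + 1)
    have h3 : 4 * Real.pi ^ 2 *
        (freqNormSq (design.K n) * (design.a n ^ 2 / ‖shearSymbol (ν j) mom (design.K n)‖ ^ 2))
        ≤ 4 * Real.pi ^ 2 * ∑ i ∈ Finset.range (n + 1),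
          freqNormSq (design.K i) * (design.a i ^ 2 / ‖shearSymbol (ν j) mom (design.K i)‖ ^ 2) := by
      refine mul_le_mul_of_nonneg_left ?_ (by positivity)
      have := Finset.single_le_sum (f := fun i => freqNormSq (design.K i) *
          (design.a i ^ 2 / ‖shearSymbol (ν j) mom (design.K i)‖ ^ 2))
        (fun i _ => mul_nonneg (freqNormSq_nonneg _) (by positivity))
        (Finset.self_mem_range_succ n)
      exact this
    have h4 : (1 : ℝ) ≤ 2 * Real.pi ^ 2 := by nlinarith [Real.pi_gt_three]
    have h5 : (0 : ℝ) ≤ 25 ^ n := by positivity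
    nlinarith

/-- **The first rung below the zeroth law (small divisors).** There is a FIXED smooth,
divergence-free, mean-zero force on `T³` such that along EVERY vanishing sequence of positive
viscosities there are global Leray–Hopf solutions with uniformly bounded mean energy whose mean
enstrophy `meanDissipation / ν` tends to infinity. Compare `Literature.Turb.ZerothLaw`, which asks
for `meanDissipation ≥ ε > 0` itself. [folklore] -/
theorem exists_force_boundedEnergy_unboundedEnstrophy :
    ∃ f : 𝕋³ → E³, Torus.IsSmooth f ∧ Torus.IsDivFree f ∧ Torus.HasZeroMean f ∧
      ∀ ν : ℕ → ℝ, (∀ j, 0 < ν j) → Tendsto ν atTop (𝓝 0) →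
        ∃ (u₀ : ℕ → 𝕋³ → E³) (u : ℕ → ℝ → 𝕋³ → E³),
          (∀ j, Torus.IsGlobalLerayHopf (ν j) (fun _ => f) (u₀ j) (u j)) ∧
          (∃ E : ℝ, ∀ j, meanEnergy (u j) ≤ E) ∧
          Tendsto (fun j => meanDissipation (ν j) (u j) / ν j) atTop atTop := by
  refine ⟨design.force, design.isSmooth_force, design.isDivFree_force, design.hasZeroMean_force,
    fun ν hν hν0 => ?_⟩
  obtain ⟨u, hLH, -, hE, -, hZ, -, -⟩ := exists_family ν hν hν0
  exact ⟨u, fun j _ => u j, hLH, ⟨_, hE⟩, hZ⟩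

end SmallDivisor

end Summit.AnomalousDissipation.AnomalousDissipation.Theorems

end
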